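import Summits.Ventures.CertifiedArithmetic.LowPrec.SRKahanHull
import HarnessLib

/-!
# Stochastic rounding into a finite format, XXXV: unbiased until a shifted summand hits the top

HONEST FRAMING: certified error envelopes and provably optimal rounding/accumulation schemes for
low-precision formats under stated cost models; every table by two implementations; no hardware or
vendor claims.

Venture CertifiedArithmetic / lowprec, SR slice (gen8, part 4). Kahan's loop `y = SR(x − c)`,
`t = SR(s + y)`, `d = SR(t − s)`, `c' = SR(d − y)` under the saturating stochastic rounding of
[ConnollyHighamMary2021, (2.1), (2.5)] is exactly unbiased under `NoSatK` (file XXIX), which by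
file XXXIV is TWO conditions on every branch: the shifted summand `x − c` and the recovery argument
`t − s` lie in the hull. This file trades the branch-dependent recovery condition for a condition
on the shifted summand alone, in EVERY format `φ` (`M = maxRat`, `G = 2^(emaxCode−1)·quantum` the
spacing of the top binade):

* `dsub_inHull_of_gap` / `valueSet_dsub_inHull` — if `s ∈ F` and `|y| + G ≤ M` then on both
  branches `t ∈ SR(s + y)` the recovery argument `t − s` lies in the hull, ALSO when the large
  addition saturates: in the hull `|t − (s + y)| ≤ G`, and a saturated `t = ±M` has `t − s`
  between `0` and `±M` because `s` then has the sign of `t`.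
* `TopSafe F G M e := InHull F e ∧ (both SR candidates y of e satisfy |y| + G ≤ M)`; for the
  formats E2M1 / E3M2 / E2M3 this says: `e` is in range and does not round to `±M`
  (`e2m1_topSafe_iff`, `e3m2_topSafe_iff`, `e2m3_topSafe_iff`, kernel).
* `noSatK_of_topSafe` — **every format, every `n`, every representable start `s`:** if on every
  branch every shifted summand `x_k − c_k` is `TopSafe`, then `NoSatK` holds; hence
  (`kahanExp_sub_of_topSafe`, `kahanExp_sq_sub_of_topSafe`) the corrected sum `s − c` is EXACTLY
  unbiased and its mean square error is exactly `kahanVar` — with nothing asked of the partial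
  sums, the large additions, the recoveries or the corrections.
* HONEST: the criterion is sufficient, not necessary (`e2m1_topSafe_strict`: summand `6 = M`
  from `(0, 0)` violates it while `NoSatK` holds), and it is sharp at the top code: with
  `|y| = M` the recovery CAN saturate and bias the result (file XXXIV, `e2m1_recovery_witness`).
  `e2m1_topSafe_overflow`: from `s = 6 = M` two summands `2` saturate both large additions, the
  criterion holds, and `E[s − c] = 10` exactly (the overflow is carried by `c = −4`).
-/

namespace Summit.Ventures.CertifiedArithmetic.LowPrec.SR

open Literature.ComputerArithmetic.ConnollyHighamMary2021
open Literature.ComputerArithmetic.FloatingPoint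
open Literature.ComputerArithmetic.FloatingPoint.MiniFloat

section General

variable {K : Type*} [Field K] [LinearOrder K] [IsStrictOrderedRing K]

/-- On the hull both saturating SR candidates lie within the gap bound `G` of the argument. -/
theorem up_dn_window {F : Finset K} {G : K}
    (hgap : ∀ e, InHull F e → roundUp F e - roundDown F e ≤ G) {e : K} (he : InHull F e) :
    (e - G ≤ up F e ∧ up F e ≤ e + G) ∧ (e - G ≤ dn F e ∧ dn F e ≤ e + G) := by
  have h1 : up F e = roundUp F e := by
    show roundUp F (clamp F e) = _
    rw [clamp_eq_self he]
  have h2 : dn F e = roundDown F e := by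
    show roundDown F (clamp F e) = _
    rw [clamp_eq_self he]
  have h3 := hgap e he
  have h4 := le_roundUp F e
  have h5 := roundDown_le F e
  rw [h1, h2]
  exact ⟨⟨by linarith, by linarith⟩, by linarith, by linarith⟩

/-- **The recovery argument stays in the hull below the top code.** `F ⊆ [−M, M]` with
`±M ∈ F` and candidate gap `≤ G` on the hull; if `s ∈ F` and `|y| + G ≤ M` then on both branches
`t ∈ SR(s + y)` — saturating or not — `t − s` lies in the hull. -/
theorem dsub_inHull_of_gap {F : Finset K} {M G : K} (hM : M ∈ F) (hmM : -M ∈ F)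
    (hle : ∀ v ∈ F, |v| ≤ M) (hG : 0 ≤ G)
    (hgap : ∀ e, InHull F e → roundUp F e - roundDown F e ≤ G)
    {s y : K} (hs : s ∈ F) (hy : |y| + G ≤ M) :
    OnBoth F (s + y) fun t => InHull F (t - s) := by
  have hF : F.Nonempty := ⟨M, hM⟩
  have hdu : ∀ e : K, dn F e ≤ up F e := fun e => roundDown_le_roundUp F _
  obtain ⟨hs₁, hs₂⟩ := abs_le.mp (hle s hs)
  obtain ⟨hy₁, hy₂⟩ := abs_le.mp (show |y| ≤ M - G by linarith)
  have main : ∀ t ∈ F, (s + y ≤ -M → t ≤ -M) → (M ≤ s + y → M ≤ t) →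
      (InHull F (s + y) → s + y - G ≤ t ∧ t ≤ s + y + G) → InHull F (t - s) := by
    intro t ht h₁ h₂ h₃
    obtain ⟨ht₁, ht₂⟩ := abs_le.mp (hle t ht)
    have key : -M ≤ t - s ∧ t - s ≤ M := by
      rcases le_or_gt (s + y) (-M) with he | he
      · have := h₁ he
        constructor <;> linarith
      rcases le_or_gt M (s + y) with he' | he'
      · have := h₂ he'
        constructor <;> linarith
      · have := h₃ ⟨⟨-M, hmM, he.le⟩, M, hM, he'.le⟩
        constructor <;> linarith
    exact ⟨⟨-M, hmM, key.1⟩, M, hM, key.2⟩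
  exact ⟨main _ (up_mem hF _) (fun h => up_le_of_mem hmM h)
      (fun h => (le_dn_of_mem hM h).trans (hdu _)) (fun h => (up_dn_window hgap h).1),
    main _ (dn_mem hF _) (fun h => (hdu _).trans (up_le_of_mem hmM h))
      (fun h => le_dn_of_mem hM h) (fun h => (up_dn_window hgap h).2)⟩

/-- `TopSafe F G M e`: the argument `e` of a shifted-summand operation is in the hull and both its
SR candidates `y` satisfy `|y| + G ≤ M` (for a format: `e` does not round to `±M`). -/
def TopSafe (F : Finset K) (G M e : K) : Prop :=
  InHull F e ∧ OnBoth F e fun y => |y| + G ≤ M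

/-- `TopSafe` is decidable. -/
instance instDecidableTopSafe (F : Finset K) (G M e : K) : Decidable (TopSafe F G M e) := by
  unfold TopSafe OnBoth; infer_instance

end General

/-! ### Every format -/

section Formats

variable {φ : Format}

/-- Every format: `s ∈ F_φ`, `|y| + 2^(emaxCode−1)·quantum ≤ maxRat` ⇒ on both branches
`t ∈ SR(s + y)` the recovery argument `t − s` is in `[−maxRat, maxRat]`. -/
theorem valueSet_dsub_inHull {s y : ℚ} (hs : s ∈ valueSet φ)
    (hy : |y| + 2 ^ (φ.emaxCode - 1) * φ.quantum ≤ φ.maxRat) :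
    OnBoth (valueSet φ) (s + y) fun t => InHull (valueSet φ) (t - s) :=
  dsub_inHull_of_gap (maxRat_mem_valueSet φ) (neg_maxRat_mem_valueSet φ)
    (fun _ hv => abs_le_maxRat_of_mem_valueSet hv)
    (mul_nonneg (pow_nonneg (by norm_num) _) φ.quantum_pos.le)
    (fun _ he => valueSet_gap_le_top φ he) hs hy

/-- Every format, one step: from `s ∈ F_φ` with a `TopSafe` shifted summand `x − c`, all three
small-operation hull conditions of the step hold (recovery: `valueSet_dsub_inHull`; correction:
file XXXIV). -/
theorem stepSmall_of_topSafe {x s c : ℚ} (hs : s ∈ valueSet φ)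
    (h : TopSafe (valueSet φ) (2 ^ (φ.emaxCode - 1) * φ.quantum) φ.maxRat (x - c)) :
    StepSmall (valueSet φ) (InHull (valueSet φ)) (InHull (valueSet φ)) (InHull (valueSet φ))
      x s c := by
  have h0 : (0 : ℚ) ∈ valueSet φ := by simpa using toRat_mem_valueSet (MiniFloat.zero φ)
  have hF : (valueSet φ).Nonempty := ⟨0, h0⟩
  have key : ∀ y : ℚ, y ∈ valueSet φ → |y| + 2 ^ (φ.emaxCode - 1) * φ.quantum ≤ φ.maxRat →
      OnBoth (valueSet φ) (s + y) fun t => InHull (valueSet φ) (t - s) ∧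
        OnBoth (valueSet φ) (t - s) fun d => InHull (valueSet φ) (d - y) :=
    fun y hy hyG => (valueSet_dsub_inHull hs hyG).and
      (csub_inHull h0 (fun v hv => neg_mem_valueSet hv) hs hy)
  exact ⟨h.1, key _ (up_mem hF _) h.2.1, key _ (dn_mem hF _) h.2.2⟩

/-- **Every format, every `n`: `NoSatK` from the shifted summands alone.** From a representable
state, if on every branch every shifted summand `x_k − c_k` is `TopSafe` (in range and not
rounding to `±maxRat`), no small operation saturates. Nothing is asked of the partial sums. -/
theorem noSatK_of_topSafe :
    ∀ (n : ℕ) (x : ℕ → ℚ) (s c : ℚ), s ∈ valueSet φ →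
      SmallOps (valueSet φ) (TopSafe (valueSet φ) (2 ^ (φ.emaxCode - 1) * φ.quantum) φ.maxRat)
        (fun _ => True) (fun _ => True) x n s c → NoSatK (valueSet φ) x n s c
  | 0, _, _, _, _, _ => trivial
  | n + 1, x, s, c, hs, h => by
      obtain ⟨⟨h1, _⟩, h3⟩ := h
      exact ⟨stepSmall_of_topSafe hs h1,
        h3.mono_mem (valueSet_nonempty φ) fun t c' ht h => noSatK_of_topSafe n _ t c' ht h⟩

/-- **Exact unbiasedness of Kahan-SR until a shifted summand hits the top code** (every format):
`E[s_n − c_n] = s − c + ∑ x_k`. -/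
theorem kahanExp_sub_of_topSafe {x : ℕ → ℚ} {n : ℕ} {s c : ℚ} (hs : s ∈ valueSet φ)
    (h : SmallOps (valueSet φ) (TopSafe (valueSet φ) (2 ^ (φ.emaxCode - 1) * φ.quantum)
      φ.maxRat) (fun _ => True) (fun _ => True) x n s c) :
    kahanExp (valueSet φ) x n (fun s c => s - c) s c = s - c + ∑ i ∈ Finset.range n, x i :=
  kahanExp_sub_of_noSatK _ x n s c (noSatK_of_topSafe n x s c hs h)

/-- Under the same criterion the mean square error of the corrected sum is exactly `kahanVar`
(file XXIX's variance identity). -/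
theorem kahanExp_sq_sub_of_topSafe {x : ℕ → ℚ} {n : ℕ} {s c : ℚ} (hs : s ∈ valueSet φ)
    (h : SmallOps (valueSet φ) (TopSafe (valueSet φ) (2 ^ (φ.emaxCode - 1) * φ.quantum)
      φ.maxRat) (fun _ => True) (fun _ => True) x n s c) :
    kahanExp (valueSet φ) x n (fun s' c' => (s' - c' - (s - c + ∑ i ∈ Finset.range n, x i)) ^ 2)
      s c = kahanVar (valueSet φ) x n s c :=
  kahanExp_sq_sub_sum _ x n s c (noSatK_of_topSafe n x s c hs h)

end Formats

/-! ### What the criterion says in FP4 / FP6, and honest limits (kernel decisions) -/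

section Kernel

open FP4 (e2m1)
open Formats (e3m2 e2m3)

/-- E2M1 (`M = 6`, `G = 2`): a candidate passes iff it is not `±6`. -/
theorem e2m1_topSafe_iff : ∀ y ∈ e2m1, |y| + 2 ≤ (6 : ℚ) ↔ (y ≠ 6 ∧ y ≠ -6) := by
  decide +kernel

/-- E3M2 (`M = 28`, `G = 4`): a candidate passes iff it is not `±28`. -/
theorem e3m2_topSafe_iff : ∀ y ∈ e3m2, |y| + 4 ≤ (28 : ℚ) ↔ (y ≠ 28 ∧ y ≠ -28) := by
  decide +kernel

/-- E2M3 (`M = 15/2`, `G = 1/2`): a candidate passes iff it is not `±15/2`. -/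
theorem e2m3_topSafe_iff :
    ∀ y ∈ e2m3, |y| + 1 / 2 ≤ (15 / 2 : ℚ) ↔ (y ≠ 15 / 2 ∧ y ≠ -15 / 2) := by
  decide +kernel

/-- The format constants of E2M1: the criterion of the theorems above is `TopSafe e2m1 2 6`. -/
theorem valueSet_E2M1_topSafe_eq :
    TopSafe (valueSet Format.E2M1) (2 ^ (Format.E2M1.emaxCode - 1) * Format.E2M1.quantum)
      Format.E2M1.maxRat = TopSafe e2m1 2 6 := by
  rw [← e2m1_eq_valueSet, Format.E2M1_maxRat.1, Format.E2M1_maxRat.2]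
  norm_num [Format.E2M1]

/-- HONEST: sufficient, not necessary. E2M1 from `(0, 0)`, summand `6 = M`: the criterion fails
(the shifted summand IS the top code) while `NoSatK` holds (`t = 6`, `d = 6`, `c' = 0`). -/
theorem e2m1_topSafe_strict :
    NoSatK e2m1 (fun _ => 6) 1 0 0
    ∧ ¬ SmallOps e2m1 (TopSafe e2m1 2 6) (fun _ => True) (fun _ => True) (fun _ => 6) 1 0 0 := by
  refine ⟨?_, ?_⟩ <;> decide +kernel

/-- Overflow is allowed: E2M1 from `s = 6 = M`, two summands `2`: both large additions saturate
(`t = 6` twice), the criterion holds on every branch (`y = 2`, then `y = 4`), and the corrected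
sum is exactly unbiased, `E[s − c] = 6 − (−4) = 10 = 6 + 2 + 2` — beyond the range. -/
theorem e2m1_topSafe_overflow :
    SmallOps e2m1 (TopSafe e2m1 2 6) (fun _ => True) (fun _ => True) (fun _ => 2) 2 6 0
    ∧ kahanExp e2m1 (fun _ => 2) 2 (fun s c => s - c) 6 0 = 10 := by
  refine ⟨?_, ?_⟩ <;> decide +kernel

/-- The same two facts over `valueSet E2M1`, by the every-format theorem and the bridge. -/
theorem valueSet_E2M1_topSafe_overflow :
    kahanExp (valueSet Format.E2M1) (fun _ => 2) 2 (fun s c => s - c) 6 0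
      = 6 - 0 + ∑ i ∈ Finset.range 2, (fun _ => (2 : ℚ)) i :=
  kahanExp_sub_of_topSafe (by rw [← e2m1_eq_valueSet]; decide +kernel)
    (by rw [valueSet_E2M1_topSafe_eq, ← e2m1_eq_valueSet]; exact e2m1_topSafe_overflow.1)

end Kernel

end Summit.Ventures.CertifiedArithmetic.LowPrec.SR
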